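import Mathlib
import HarnessLib
import Literature.MathematicalPhysics.QuantumLattice.HubbardFreePropagatorTorusDecay

/-!
# Route `KLProgramme`, crux K3 — engine-flow child (stmt-HubbardSuperconductivity-20437), stub (C) at `n = 0`, located brick «A-SIZES-WEIGHTED» (pen (R181)),
# brick 4f (i): A NUMERAL BOUND FOR THE LATTICE SUMS `S_m = Σ'_{z∈ℤ²} (1+‖z‖_∞)^{−m} ≤ 9` (`m ≥ 4`)

Cell gate-hubbard-kl, seat p1 g21.  The weighted sizes `a_k` of brick 4e carry the lattice constants `S₄` and `S_{k+4}` (as do brick 1's off-site jets and the §2e envelope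
door, through `1 + 4ⁿS_n`).  Here: `Σ'_{n∈ℤ} (1+|n|)^{−2} = π²/3 − 1 ≤ 3` (Mathlib `hasSum_zeta_two`), the product bound `(1+‖z‖_∞)^4 ≥ (1+|z₀|)²(1+|z₁|)²`, hence
**`tsum_inv_one_add_norm_pow_le_nine`**: `Σ'_{z : Site 2} ((1+‖z‖)^m)⁻¹ ≤ 9` for every `m ≥ 4`.

Proofs only; no definitions; nothing here asserts (C), any stub of 20437, K3 or superconductivity.  References: BGM 2006 §2.4 (2.80) (lattice sums of the decay
bookkeeping) [cite: BenfattoGiulianiMastropietro2006].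
-/

noncomputable section

namespace Summit.HubbardSuperconductivity.HubbardSuperconductivity.Theorems.KLRegimeSplit

set_option linter.dupNamespace false -- summit = problem name (single-conjunct summit), D-0017

open Literature.MathematicalPhysics.QuantumLattice Literature.Probability.LatticeModels Finset Real

/-- **`Σ_{n∈ℤ} (1+|n|)^{−2} = π²/6 + (π²/6 − 1)`** (the two half-lines are shifted `ζ(2)` series). -/
theorem hasSum_int_inv_one_add_norm_sq : HasSum (fun n : ℤ => ((1 + ‖n‖) ^ 2)⁻¹) (π ^ 2 / 6 + (π ^ 2 / 6 - 1)) := by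
  have hz := hasSum_zeta_two
  -- nonnegative half-line: `n ↦ 1/(n+1)²`
  have h1 : HasSum (fun n : ℕ => (1 : ℝ) / (((n + 1 : ℕ) : ℝ)) ^ 2) (π ^ 2 / 6) := by
    refine (hasSum_nat_add_iff (f := fun n : ℕ => (1 : ℝ) / (n : ℝ) ^ 2) (g := π ^ 2 / 6) 1).2 ?_
    simpa using hz
  have hpos : HasSum (fun n : ℕ => ((1 + ‖((n : ℕ) : ℤ)‖) ^ 2)⁻¹) (π ^ 2 / 6) := by
    refine h1.congr_fun fun n => ?_
    rw [Int.norm_natCast, one_div]; push_cast; ring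
  -- negative half-line: `n ↦ 1/(n+2)²`
  have h2 : HasSum (fun n : ℕ => (1 : ℝ) / (((n + 2 : ℕ) : ℝ)) ^ 2) (π ^ 2 / 6 - 1) := by
    refine (hasSum_nat_add_iff (f := fun n : ℕ => (1 : ℝ) / (n : ℝ) ^ 2) (g := π ^ 2 / 6 - 1) 2).2 ?_
    have hs : ∑ i ∈ Finset.range 2, (1 : ℝ) / ((i : ℕ) : ℝ) ^ 2 = 1 := by
      simp [Finset.sum_range_succ]
    rw [hs]
    simpa using hz
  have hneg : HasSum (fun n : ℕ => ((1 + ‖(-((n : ℤ) + 1))‖) ^ 2)⁻¹) (π ^ 2 / 6 - 1) := by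
    refine h2.congr_fun fun n => ?_
    rw [norm_neg, show ((n : ℤ) + 1) = ((n + 1 : ℕ) : ℤ) by push_cast; ring, Int.norm_natCast, one_div]
    push_cast; ring
  exact HasSum.of_nat_of_neg_add_one hpos hneg

/-- `Σ'_{n∈ℤ} (1+|n|)^{−2} ≤ 3` (`π² ≤ 12`). -/
theorem tsum_int_inv_one_add_norm_sq_le_three : ∑' n : ℤ, ((1 + ‖n‖) ^ 2)⁻¹ ≤ 3 := by
  rw [hasSum_int_inv_one_add_norm_sq.tsum_eq]
  have hπ : π < 3.15 := Real.pi_lt_d2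
  nlinarith [Real.pi_pos]

/-- **`S_m ≤ 9` for `m ≥ 4`**: `Σ'_{z∈ℤ²} (1+‖z‖_∞)^{−m} ≤ (Σ'_{n∈ℤ}(1+|n|)^{−2})² ≤ 9`. -/
theorem tsum_inv_one_add_norm_pow_le_nine {m : ℕ} (hm : 4 ≤ m) : ∑' z : Site 2, ((1 + ‖z‖) ^ m)⁻¹ ≤ 9 := by
  set g : ℤ → ℝ := fun n => ((1 + ‖n‖) ^ 2)⁻¹ with hg
  have hg0 : ∀ n, 0 ≤ g n := fun n => by positivity
  have hgs : HasSum g (π ^ 2 / 6 + (π ^ 2 / 6 - 1)) := hasSum_int_inv_one_add_norm_sq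
  set s : ℝ := π ^ 2 / 6 + (π ^ 2 / 6 - 1) with hs
  have hs3 : s ≤ 3 := by rw [hs, ← hasSum_int_inv_one_add_norm_sq.tsum_eq]; exact tsum_int_inv_one_add_norm_sq_le_three
  have hs0 : 0 ≤ s := by rw [← hgs.tsum_eq]; exact tsum_nonneg hg0
  -- the product series on `ℤ × ℤ`, transported to `Site 2 = Fin 2 → ℤ`
  have hprod : HasSum (fun x : ℤ × ℤ => g x.1 * g x.2) (s * s) :=
    hgs.mul hgs (hgs.summable.mul_of_nonneg hgs.summable hg0 hg0)
  have hprod' : HasSum (fun z : Site 2 => g (z 0) * g (z 1)) (s * s) := by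
    have h := (finTwoArrowEquiv ℤ).hasSum_iff.2 hprod
    exact h
  -- termwise comparison
  have hle : ∀ z : Site 2, ((1 + ‖z‖) ^ m)⁻¹ ≤ g (z 0) * g (z 1) := by
    intro z
    have h0 : ‖z 0‖ ≤ ‖z‖ := norm_le_pi_norm z 0
    have h1 : ‖z 1‖ ≤ ‖z‖ := norm_le_pi_norm z 1
    have hz1 : 1 ≤ 1 + ‖z‖ := by linarith [norm_nonneg z]
    rw [hg, ← mul_inv]
    refine inv_anti₀ (by positivity) ?_
    calc (1 + ‖z 0‖) ^ 2 * (1 + ‖z 1‖) ^ 2 ≤ (1 + ‖z‖) ^ 2 * (1 + ‖z‖) ^ 2 :=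
          mul_le_mul (pow_le_pow_left₀ (by positivity) (by linarith) 2) (pow_le_pow_left₀ (by positivity) (by linarith) 2)
            (by positivity) (by positivity)
      _ = (1 + ‖z‖) ^ 4 := by ring
      _ ≤ (1 + ‖z‖) ^ m := pow_le_pow_right₀ hz1 hm
  calc ∑' z : Site 2, ((1 + ‖z‖) ^ m)⁻¹ ≤ ∑' z : Site 2, g (z 0) * g (z 1) :=
        Summable.tsum_le_tsum hle (summable_inv_one_add_norm_pow (d := 2) (K := m) (by omega)) hprod'.summable
    _ = s * s := hprod'.tsum_eq
    _ ≤ 9 := by nlinarith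

end Summit.HubbardSuperconductivity.HubbardSuperconductivity.Theorems.KLRegimeSplit

end
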